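import Summits.QuantumFields.QCD.Theses.HeatSlicedQuarks
import Literature.MathematicalPhysics.QuantumLattice.WilsonFermionBlockAveraging

/-!
# Stub `stub_holomorphicGaugeCovariance` of line `Sketch` (crux stmt-QuantumFields-8891)

Complex gauge covariance of the holomorphic heat slice `exp(-t (Γ₅ D_W(U))²)` of the Wilson operator
over `GL(3,ℂ)`-valued links: for every complex gauge transformation `g : Λ → GL(3,ℂ)`,
`exp(-t (Γ₅ D_W(U^g))²) = 𝒢(g) exp(-t (Γ₅ D_W(U))²) 𝒢(g⁻¹)`.

Proof: the tree's `wilsonDirac_gaugeTransform` gives `D_W(U^g) = 𝒢 D_W(U) 𝒢'` with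
`𝒢 = gaugeRotation ρ (Fin 4) g`, `𝒢' = gaugeRotation ρ (Fin 4) g⁻¹`, `𝒢𝒢' = 𝒢'𝒢 = 1`
(`gaugeRotation_mul_inv`, `gaugeRotation_inv_mul`); the spin-only matrix `spinorLift Γ = 1 ⊗ (1 ⊗ Γ)`
commutes with the colour-only matrix `𝒢`, whence `(Γ₅ D_W(U^g))² = 𝒢 (Γ₅ D_W(U))² 𝒢'`; finally
`exp` is conjugation-covariant (Mathlib's `Matrix.exp_units_conj`).
-/

namespace Summit.QuantumFields.QCD.Cruxes.InterleavedHeatSliceFlow.Sketch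

open Literature.MathematicalPhysics.QuantumLattice Literature.MathematicalPhysics.QuantumFieldTheory
  Literature.Probability.LatticeModels
open scoped Matrix Kronecker

/-- The spin-only matrix `spinorLift Γ = 1 ⊗ (1 ⊗ Γ)` commutes with the colour-only gauge rotation
`𝒢(g) = gaugeRotation ρ (Fin 4) g`. -/
private theorem holomorphicGaugeCovariance_spinorLift_mul_gaugeRotation {L N : ℕ} {G : Type*}
    [Group G] (ρ : G →* Matrix (Fin N) (Fin N) ℂ) (Γ : Matrix (Fin 4) (Fin 4) ℂ)
    (g : TorusSite 4 L → G) [NeZero L] :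
    (spinorLift Γ : Matrix (TorusSite 4 L × Fin N × Fin 4) (TorusSite 4 L × Fin N × Fin 4) ℂ) *
        gaugeRotation ρ (Fin 4) g =
      gaugeRotation ρ (Fin 4) g * spinorLift Γ := by
  ext p q
  rw [mul_gaugeRotation_apply, gaugeRotation_mul_apply]
  simp only [spinorLift, Matrix.kroneckerMap_apply, Matrix.one_apply]
  by_cases h : p.1 = q.1
  · simp [h, mul_comm]
  · simp [h]

/-- **Stub `stub_holomorphicGaugeCovariance`** (card square-root-dissipativity-strips, second lemma):
the holomorphic heat slice `exp(-t (Γ₅ D_W(U))²)` of the Wilson operator over `GL(3,ℂ)`-valued links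
(tree `wilsonDirac` with `ρ = Units.coeHom`) is conjugation-covariant under COMPLEX gauge
transformations `g : Λ → GL(3,ℂ)`:
`exp(-t (Γ₅ D_W(U^g))²) = 𝒢(g) exp(-t (Γ₅ D_W(U))²) 𝒢(g⁻¹)`. -/
theorem stub_holomorphicGaugeCovariance :
    ∀ (L : ℕ) [NeZero L] (g : TorusSite 4 L → Matrix.GeneralLinearGroup (Fin 3) ℂ)
      (U : GaugeConfig 4 L (Matrix.GeneralLinearGroup (Fin 3) ℂ)) (m : ℝ) (t : ℂ),
      NormedSpace.exp (-t • (spinorLift gammaFive *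
          wilsonDirac (Units.coeHom (Matrix (Fin 3) (Fin 3) ℂ)) (gaugeTransform g U) m 1) ^ 2) =
        gaugeRotation (Units.coeHom (Matrix (Fin 3) (Fin 3) ℂ)) (Fin 4) g *
          NormedSpace.exp (-t • (spinorLift gammaFive *
            wilsonDirac (Units.coeHom (Matrix (Fin 3) (Fin 3) ℂ)) U m 1) ^ 2) *
          gaugeRotation (Units.coeHom (Matrix (Fin 3) (Fin 3) ℂ)) (Fin 4) g⁻¹ := by
  intro L _ g U m t
  set ρ := Units.coeHom (Matrix (Fin 3) (Fin 3) ℂ)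
  set 𝒢 := gaugeRotation ρ (Fin 4) g
  set 𝒢' := gaugeRotation ρ (Fin 4) g⁻¹
  set Γ := (spinorLift gammaFive :
    Matrix (TorusSite 4 L × Fin 3 × Fin 4) (TorusSite 4 L × Fin 3 × Fin 4) ℂ)
  set D := wilsonDirac ρ U m 1
  have h1 : 𝒢 * 𝒢' = 1 := gaugeRotation_mul_inv ρ g
  have h2 : 𝒢' * 𝒢 = 1 := gaugeRotation_inv_mul ρ g
  have hcomm : Γ * 𝒢 = 𝒢 * Γ :=
    holomorphicGaugeCovariance_spinorLift_mul_gaugeRotation ρ gammaFive g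
  have hD : wilsonDirac ρ (gaugeTransform g U) m 1 = 𝒢 * D * 𝒢' :=
    wilsonDirac_gaugeTransform ρ g U m 1
  have hsq : (Γ * (𝒢 * D * 𝒢')) ^ 2 = 𝒢 * (Γ * D) ^ 2 * 𝒢' := by
    calc (Γ * (𝒢 * D * 𝒢')) ^ 2 = (𝒢 * (Γ * D) * 𝒢') ^ 2 := by
          rw [← Matrix.mul_assoc, ← Matrix.mul_assoc, hcomm, Matrix.mul_assoc 𝒢 Γ D]
      _ = 𝒢 * (Γ * D) * (𝒢' * 𝒢) * (Γ * D) * 𝒢' := by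
          rw [pow_two]; simp only [Matrix.mul_assoc]
      _ = 𝒢 * (Γ * D) ^ 2 * 𝒢' := by
          rw [h2, Matrix.mul_one, pow_two, Matrix.mul_assoc 𝒢 (Γ * D) (Γ * D)]
  have hsmul : -t • (𝒢 * (Γ * D) ^ 2 * 𝒢') = 𝒢 * (-t • (Γ * D) ^ 2) * 𝒢' := by
    rw [Matrix.mul_smul, Matrix.smul_mul]
  rw [hD, hsq, hsmul]
  exact Matrix.exp_units_conj ⟨𝒢, 𝒢', h1, h2⟩ _

end Summit.QuantumFields.QCD.Cruxes.InterleavedHeatSliceFlow.Sketch
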